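import Literature.AlgebraicGeometry.Frobenioids.OrderedHomEquivalenceTransport
import HarnessLib

/-!
# Frobenioids II, §0 (p. 6): isomorphisms are continuously ordered; totally / continuously ordered
# monomorphisms are stable under composition with isomorphisms

Mochizuki, *The geometry of Frobenioids II: poly-Frobenioids*, Kyushu J. Math. **62** (2008)
401–460, §0 "Notations and Conventions", paragraph **Categories**, kurims text p. 6
[cite: MochizukiFrdII2008, §0 p.6] (totally / continuously ordered monomorphisms `φ`, defined through
the category `C^↣_φ` of factorizations of `φ` through monomorphisms; typed in `Dissection.lean`,
abc-iut-L1-t4).  Sequel to `OrderedHomEquivalenceTransport.lean`, which turned the p. 6 bracket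
"[so `E` may be recovered as the set of isomorphism classes of `C^↣_φ` …]" into the criteria
`isTotallyOrderedHom_iff` / `isContinuouslyOrderedHom_iff`.  PROOF-ONLY (no definitions, no
instances).  Contents:

* `MonoFactorisations.nonempty_hom_of_isIso`, `IsTotallyOrderedHom.of_isIso`,
  `IsContinuouslyOrderedHom.of_isIso`: for an isomorphism `φ` any two objects of `C^↣_φ` are joined by
  an arrow, so `C^↣_φ ≃ Order(pt)` and `φ` is continuously (hence totally) ordered.  (Consequently the
  clause "is an isomorphism or" in the p. 6 definition of *quasi*-totally / -continuously ordered is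
  redundant; see the sequel `OrderedHomQuasiEquivalenceTransport.lean`.)
* `mono_conj_iff`, `MonoFactorisations.exists_conj`, `….exists_conj_preimage`,
  `….nonempty_hom_iff_conj`, `monoFactorisations_comparable_iff_conj`, `monoFactorisations_dense_iff_conj`:
  for isomorphisms `i : A' ≅ A`, `j : B ≅ B'` the categories `C^↣_{i ≫ φ ≫ j}` and `C^↣_φ` correspond
  object by object (same middle object, legs conjugated) and arrow by arrow;
* `isTotallyOrderedHom_conj_iff`, `isContinuouslyOrderedHom_conj_iff` and the one-sided corollaries
  `IsTotallyOrderedHom.iso_comp` / `.comp_iso`, `IsContinuouslyOrderedHom.iso_comp` / `.comp_iso`: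
  `i ≫ φ ≫ j` is totally / continuously ordered iff `φ` is — needed to absorb the (co)unit
  isomorphisms when transporting the *quasi* notions along an equivalence of categories.

Elementary category theory; nothing here bears on the disputed [IUTchIII] Cor. 3.12 or takes a side;
no FACT-LIST row is asserted (abc-iut cell, seat abc-iut-f-031, by-product of tranche 31
`IsOfTotallyOrderedType` F-2333 / `IsOfQuasiTotallyOrderedType` F-2334).
-/

namespace Literature.AlgebraicGeometry.Frobenioids

open CategoryTheory

universe v₁ u₁

variable {C : Type u₁} [Category.{v₁} C]

/-! ### Isomorphisms are continuously ordered -/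

/-- For an isomorphism `φ`, any two mono-factorisations `A ↣ X₁ ↣ B`, `A ↣ X₂ ↣ B` of `φ` are joined
by the arrow `X₁ ↣ B ≅ A ↣ X₂` of `C^↣_φ` (so all objects of `C^↣_φ` are isomorphic).
[cite: MochizukiFrdII2008, §0 p.6] -/
theorem MonoFactorisations.nonempty_hom_of_isIso {A B : C} {φ : A ⟶ B} [IsIso φ]
    (G₁ G₂ : MonoFactorisations φ) : Nonempty (G₁ ⟶ G₂) :=
  ⟨ObjectProperty.homMk
    { h := G₁.obj.π ≫ inv φ ≫ G₂.obj.ι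
      ι_h := by rw [G₁.obj.ι_π_assoc, IsIso.hom_inv_id_assoc]
      h_π := by simp only [Category.assoc, G₂.obj.ι_π, IsIso.inv_hom_id, Category.comp_id] }⟩

/-- An isomorphism is totally ordered: `C^↣_φ ≃ Order(pt)`. [cite: MochizukiFrdII2008, §0 p.6] -/
theorem IsTotallyOrderedHom.of_isIso {A B : C} (φ : A ⟶ B) [IsIso φ] : IsTotallyOrderedHom φ :=
  (isTotallyOrderedHom_iff φ).mpr
    ⟨inferInstance, fun G₁ G₂ => Or.inl (MonoFactorisations.nonempty_hom_of_isIso G₁ G₂)⟩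

/-- An isomorphism is continuously ordered (the density condition is vacuous on `Order(pt)`).
[cite: MochizukiFrdII2008, §0 p.6] -/
theorem IsContinuouslyOrderedHom.of_isIso {A B : C} (φ : A ⟶ B) [IsIso φ] :
    IsContinuouslyOrderedHom φ :=
  (isContinuouslyOrderedHom_iff φ).mpr
    ⟨inferInstance, fun G₁ G₂ => Or.inl (MonoFactorisations.nonempty_hom_of_isIso G₁ G₂),
      fun G₁ G₂ _ h₂₁ => (h₂₁.false (MonoFactorisations.nonempty_hom_of_isIso G₂ G₁).some).elim⟩

/-! ### Composition with isomorphisms: `C^↣_{i ≫ φ ≫ j} ≅ C^↣_φ` -/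

/-- `i ≫ φ ≫ j` (with `i`, `j` isomorphisms) is a monomorphism iff `φ` is.
[cite: MochizukiFrdII2008, §0 p.6] -/
theorem mono_conj_iff {A A' B B' : C} (i : A' ≅ A) (j : B ≅ B') {φ : A ⟶ B} {φ' : A' ⟶ B'}
    (h : φ' = i.hom ≫ φ ≫ j.hom) : Mono φ' ↔ Mono φ := by
  constructor
  · intro hm
    have hφ : φ = i.inv ≫ φ' ≫ j.inv := by simp [h]
    rw [hφ]
    infer_instance
  · intro hm
    rw [h]
    infer_instance

/-- A mono-factorisation `A ↣ X ↣ B` of `φ` gives the mono-factorisation `A' ↣ X ↣ B'` of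
`φ' = i ≫ φ ≫ j` with the same middle object. [cite: MochizukiFrdII2008, §0 p.6] -/
theorem MonoFactorisations.exists_conj {A A' B B' : C} (i : A' ≅ A) (j : B ≅ B') {φ : A ⟶ B}
    {φ' : A' ⟶ B'} (h : φ' = i.hom ≫ φ ≫ j.hom) (G : MonoFactorisations φ) :
    ∃ (G' : MonoFactorisations φ') (k : G.obj.mid ≅ G'.obj.mid),
      (i.hom ≫ G.obj.ι) ≫ k.hom = G'.obj.ι ∧ k.hom ≫ G'.obj.π = G.obj.π ≫ j.hom := by
  have hG : Mono G.obj.ι ∧ Mono G.obj.π := G.property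
  haveI := hG.1
  haveI := hG.2
  refine ⟨⟨{ mid := G.obj.mid
             ι := i.hom ≫ G.obj.ι
             π := G.obj.π ≫ j.hom
             ι_π := by rw [h, Category.assoc, G.obj.ι_π_assoc] }, ⟨inferInstance, inferInstance⟩⟩,
    Iso.refl _, ?_, ?_⟩
  · exact Category.comp_id _
  · exact Category.id_comp _

/-- Conversely a mono-factorisation `A' ↣ X' ↣ B'` of `φ' = i ≫ φ ≫ j` comes from the
mono-factorisation `A ↣ X' ↣ B` of `φ` with legs `i⁻¹ ≫ ι'`, `π' ≫ j⁻¹`.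
[cite: MochizukiFrdII2008, §0 p.6] -/
theorem MonoFactorisations.exists_conj_preimage {A A' B B' : C} (i : A' ≅ A) (j : B ≅ B')
    {φ : A ⟶ B} {φ' : A' ⟶ B'} (h : φ' = i.hom ≫ φ ≫ j.hom) (G' : MonoFactorisations φ') :
    ∃ (G : MonoFactorisations φ) (k : G.obj.mid ≅ G'.obj.mid),
      (i.hom ≫ G.obj.ι) ≫ k.hom = G'.obj.ι ∧ k.hom ≫ G'.obj.π = G.obj.π ≫ j.hom := by
  have hG' : Mono G'.obj.ι ∧ Mono G'.obj.π := G'.property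
  haveI := hG'.1
  haveI := hG'.2
  have hφ : φ = i.inv ≫ φ' ≫ j.inv := by simp [h]
  refine ⟨⟨{ mid := G'.obj.mid
             ι := i.inv ≫ G'.obj.ι
             π := G'.obj.π ≫ j.inv
             ι_π := by rw [hφ, Category.assoc, G'.obj.ι_π_assoc] }, ⟨inferInstance, inferInstance⟩⟩,
    Iso.refl _, ?_, ?_⟩
  · show (i.hom ≫ i.inv ≫ G'.obj.ι) ≫ 𝟙 _ = G'.obj.ι
    rw [Iso.hom_inv_id_assoc, Category.comp_id]
  · show 𝟙 _ ≫ G'.obj.π = (G'.obj.π ≫ j.inv) ≫ j.hom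
    rw [Category.id_comp, Category.assoc, Iso.inv_hom_id, Category.comp_id]

/-- Under such identifications the arrows of `C^↣_φ` and `C^↣_{i ≫ φ ≫ j}` correspond.
[cite: MochizukiFrdII2008, §0 p.6] -/
theorem MonoFactorisations.nonempty_hom_iff_conj {A A' B B' : C} (i : A' ≅ A) (j : B ≅ B')
    {φ : A ⟶ B} {φ' : A' ⟶ B'} {G₁ G₂ : MonoFactorisations φ} {G₁' G₂' : MonoFactorisations φ'}
    (k₁ : G₁.obj.mid ≅ G₁'.obj.mid) (h₁ι : (i.hom ≫ G₁.obj.ι) ≫ k₁.hom = G₁'.obj.ι)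
    (h₁π : k₁.hom ≫ G₁'.obj.π = G₁.obj.π ≫ j.hom)
    (k₂ : G₂.obj.mid ≅ G₂'.obj.mid) (h₂ι : (i.hom ≫ G₂.obj.ι) ≫ k₂.hom = G₂'.obj.ι)
    (h₂π : k₂.hom ≫ G₂'.obj.π = G₂.obj.π ≫ j.hom) :
    Nonempty (G₁ ⟶ G₂) ↔ Nonempty (G₁' ⟶ G₂') := by
  have h₁ι' : i.hom ≫ G₁.obj.ι ≫ k₁.hom = G₁'.obj.ι := by simpa only [Category.assoc] using h₁ι
  have h₂ι' : i.hom ≫ G₂.obj.ι ≫ k₂.hom = G₂'.obj.ι := by simpa only [Category.assoc] using h₂ι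
  constructor
  · rintro ⟨g⟩
    refine ⟨ObjectProperty.homMk ⟨k₁.inv ≫ g.hom.h ≫ k₂.hom, ?_, ?_⟩⟩
    · rw [← h₁ι', ← h₂ι']
      simp only [Category.assoc, Iso.hom_inv_id_assoc]
      rw [g.hom.ι_h_assoc]
    · simp only [Category.assoc]
      rw [h₂π, g.hom.h_π_assoc]
      exact ((k₁.eq_inv_comp).mpr h₁π).symm
  · rintro ⟨g'⟩
    refine ⟨ObjectProperty.homMk ⟨k₁.hom ≫ g'.hom.h ≫ k₂.inv, ?_, ?_⟩⟩
    · apply (cancel_epi i.hom).mp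
      rw [reassoc_of% h₁ι', g'.hom.ι_h_assoc, ← h₂ι', Category.assoc, Category.assoc,
        Iso.hom_inv_id, Category.comp_id]
    · apply (cancel_mono j.hom).mp
      simp only [Category.assoc]
      rw [← (k₂.eq_inv_comp).mpr h₂π, g'.hom.h_π, h₁π]

/-- Any two mono-factorisations of `i ≫ φ ≫ j` are comparable iff any two mono-factorisations of
`φ` are. [cite: MochizukiFrdII2008, §0 p.6] -/
theorem monoFactorisations_comparable_iff_conj {A A' B B' : C} (i : A' ≅ A) (j : B ≅ B')
    {φ : A ⟶ B} {φ' : A' ⟶ B'} (h : φ' = i.hom ≫ φ ≫ j.hom) :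
    (∀ G₁' G₂' : MonoFactorisations φ', Nonempty (G₁' ⟶ G₂') ∨ Nonempty (G₂' ⟶ G₁')) ↔
      ∀ G₁ G₂ : MonoFactorisations φ, Nonempty (G₁ ⟶ G₂) ∨ Nonempty (G₂ ⟶ G₁) := by
  constructor
  · intro htot
    refine comparable_transfer
      (fun (G' : MonoFactorisations φ') (G : MonoFactorisations φ) => ∃ k : G.obj.mid ≅ G'.obj.mid,
        (i.hom ≫ G.obj.ι) ≫ k.hom = G'.obj.ι ∧ k.hom ≫ G'.obj.π = G.obj.π ≫ j.hom)
      (fun G => MonoFactorisations.exists_conj i j h G) (fun hR₁ hR₂ => ?_) htot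
    · obtain ⟨k₁, h₁ι, h₁π⟩ := hR₁
      obtain ⟨k₂, h₂ι, h₂π⟩ := hR₂
      exact (MonoFactorisations.nonempty_hom_iff_conj i j k₁ h₁ι h₁π k₂ h₂ι h₂π).symm
  · intro htot
    refine comparable_transfer
      (fun (G : MonoFactorisations φ) (G' : MonoFactorisations φ') => ∃ k : G.obj.mid ≅ G'.obj.mid,
        (i.hom ≫ G.obj.ι) ≫ k.hom = G'.obj.ι ∧ k.hom ≫ G'.obj.π = G.obj.π ≫ j.hom)
      (fun G' => MonoFactorisations.exists_conj_preimage i j h G') (fun hR₁ hR₂ => ?_) htot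
    · obtain ⟨k₁, h₁ι, h₁π⟩ := hR₁
      obtain ⟨k₂, h₂ι, h₂π⟩ := hR₂
      exact MonoFactorisations.nonempty_hom_iff_conj i j k₁ h₁ι h₁π k₂ h₂ι h₂π

/-- `C^↣_{i ≫ φ ≫ j}` is densely ordered iff `C^↣_φ` is. [cite: MochizukiFrdII2008, §0 p.6] -/
theorem monoFactorisations_dense_iff_conj {A A' B B' : C} (i : A' ≅ A) (j : B ≅ B')
    {φ : A ⟶ B} {φ' : A' ⟶ B'} (h : φ' = i.hom ≫ φ ≫ j.hom) :
    (∀ G₁' G₂' : MonoFactorisations φ', Nonempty (G₁' ⟶ G₂') → IsEmpty (G₂' ⟶ G₁') →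
        ∃ G₃' : MonoFactorisations φ', Nonempty (G₁' ⟶ G₃') ∧ IsEmpty (G₃' ⟶ G₁') ∧
          Nonempty (G₃' ⟶ G₂') ∧ IsEmpty (G₂' ⟶ G₃')) ↔
      ∀ G₁ G₂ : MonoFactorisations φ, Nonempty (G₁ ⟶ G₂) → IsEmpty (G₂ ⟶ G₁) →
        ∃ G₃ : MonoFactorisations φ, Nonempty (G₁ ⟶ G₃) ∧ IsEmpty (G₃ ⟶ G₁) ∧
          Nonempty (G₃ ⟶ G₂) ∧ IsEmpty (G₂ ⟶ G₃) := by
  constructor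
  · intro hd
    refine dense_transfer
      (fun (G' : MonoFactorisations φ') (G : MonoFactorisations φ) => ∃ k : G.obj.mid ≅ G'.obj.mid,
        (i.hom ≫ G.obj.ι) ≫ k.hom = G'.obj.ι ∧ k.hom ≫ G'.obj.π = G.obj.π ≫ j.hom)
      (fun G => MonoFactorisations.exists_conj i j h G)
      (fun G' => MonoFactorisations.exists_conj_preimage i j h G') (fun hR₁ hR₂ => ?_) hd
    · obtain ⟨k₁, h₁ι, h₁π⟩ := hR₁
      obtain ⟨k₂, h₂ι, h₂π⟩ := hR₂
      exact (MonoFactorisations.nonempty_hom_iff_conj i j k₁ h₁ι h₁π k₂ h₂ι h₂π).symm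
  · intro hd
    refine dense_transfer
      (fun (G : MonoFactorisations φ) (G' : MonoFactorisations φ') => ∃ k : G.obj.mid ≅ G'.obj.mid,
        (i.hom ≫ G.obj.ι) ≫ k.hom = G'.obj.ι ∧ k.hom ≫ G'.obj.π = G.obj.π ≫ j.hom)
      (fun G' => MonoFactorisations.exists_conj_preimage i j h G')
      (fun G => MonoFactorisations.exists_conj i j h G) (fun hR₁ hR₂ => ?_) hd
    · obtain ⟨k₁, h₁ι, h₁π⟩ := hR₁
      obtain ⟨k₂, h₂ι, h₂π⟩ := hR₂
      exact MonoFactorisations.nonempty_hom_iff_conj i j k₁ h₁ι h₁π k₂ h₂ι h₂π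

/-- `i ≫ φ ≫ j` is totally ordered iff `φ` is (`i`, `j` isomorphisms).
[cite: MochizukiFrdII2008, §0 p.6] -/
theorem isTotallyOrderedHom_conj_iff {A A' B B' : C} (i : A' ≅ A) (j : B ≅ B') {φ : A ⟶ B}
    {φ' : A' ⟶ B'} (h : φ' = i.hom ≫ φ ≫ j.hom) : IsTotallyOrderedHom φ' ↔ IsTotallyOrderedHom φ := by
  rw [isTotallyOrderedHom_iff, isTotallyOrderedHom_iff, mono_conj_iff i j h,
    monoFactorisations_comparable_iff_conj i j h]

/-- `i ≫ φ ≫ j` is continuously ordered iff `φ` is (`i`, `j` isomorphisms).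
[cite: MochizukiFrdII2008, §0 p.6] -/
theorem isContinuouslyOrderedHom_conj_iff {A A' B B' : C} (i : A' ≅ A) (j : B ≅ B') {φ : A ⟶ B}
    {φ' : A' ⟶ B'} (h : φ' = i.hom ≫ φ ≫ j.hom) :
    IsContinuouslyOrderedHom φ' ↔ IsContinuouslyOrderedHom φ := by
  rw [isContinuouslyOrderedHom_iff, isContinuouslyOrderedHom_iff, mono_conj_iff i j h,
    monoFactorisations_comparable_iff_conj i j h, monoFactorisations_dense_iff_conj i j h]

/-- Pre-composing a totally ordered monomorphism with an isomorphism keeps it totally ordered.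
[cite: MochizukiFrdII2008, §0 p.6] -/
theorem IsTotallyOrderedHom.iso_comp {A A' B : C} (i : A' ≅ A) {φ : A ⟶ B}
    (h : IsTotallyOrderedHom φ) : IsTotallyOrderedHom (i.hom ≫ φ) :=
  (isTotallyOrderedHom_conj_iff i (Iso.refl B) (by simp)).mpr h

/-- Post-composing a totally ordered monomorphism with an isomorphism keeps it totally ordered.
[cite: MochizukiFrdII2008, §0 p.6] -/
theorem IsTotallyOrderedHom.comp_iso {A B B' : C} {φ : A ⟶ B} (h : IsTotallyOrderedHom φ)
    (j : B ≅ B') : IsTotallyOrderedHom (φ ≫ j.hom) :=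
  (isTotallyOrderedHom_conj_iff (Iso.refl A) j (by simp)).mpr h

/-- Pre-composing a continuously ordered monomorphism with an isomorphism keeps it continuously
ordered. [cite: MochizukiFrdII2008, §0 p.6] -/
theorem IsContinuouslyOrderedHom.iso_comp {A A' B : C} (i : A' ≅ A) {φ : A ⟶ B}
    (h : IsContinuouslyOrderedHom φ) : IsContinuouslyOrderedHom (i.hom ≫ φ) :=
  (isContinuouslyOrderedHom_conj_iff i (Iso.refl B) (by simp)).mpr h

/-- Post-composing a continuously ordered monomorphism with an isomorphism keeps it continuously
ordered. [cite: MochizukiFrdII2008, §0 p.6] -/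
theorem IsContinuouslyOrderedHom.comp_iso {A B B' : C} {φ : A ⟶ B} (h : IsContinuouslyOrderedHom φ)
    (j : B ≅ B') : IsContinuouslyOrderedHom (φ ≫ j.hom) :=
  (isContinuouslyOrderedHom_conj_iff (Iso.refl A) j (by simp)).mpr h

end Literature.AlgebraicGeometry.Frobenioids
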